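import Literature.Topology.FourManifolds.Collapsible
import Literature.Topology.FourManifolds.SimplexDisc
import Literature.Topology.FourManifolds.WhitneyModelSheets
import HarnessLib

/-!
# A chart of the manifold in which a top-dimensional simplex of a smoothly embedded complex is
# flat

Topic `Literature/Topology/FourManifolds`; a step of the proof of the named fact
`Literature.Topology.FourManifolds.exists_isSmoothEmbedding_closedBall_of_isSmoothlyCollapsible`
(`Collapsible.lean`; Hirsch 1962).  Let `f : E^N → M` be a smooth non-degenerate embedding of the
finite Euclidean complex `K` into the smooth `(n+1)`-manifold `M`
(`Literature.Topology.FourManifolds.IsSmoothComplexEmbedding`: on each closed simplex `f` extends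
to a `C^∞` map of a neighbourhood whose differential is injective on the direction space of the
simplex; Munkres 1966, Def. 8.1/8.3), and let `ρ = {v₀, …, v_{n+1}}` be a face of `K` with
`n + 2` vertices.

* `IsSmoothComplexEmbedding.exists_chart_simplexAffine` — **there is a chart `Φ` of the maximal
  `C^∞` atlas of `M` whose inverse is `f ∘ A` on the model simplex** `Δ = conv(0, e₀, …, e_n)`,
  `A : ℝⁿ⁺¹ → E^N` the affine chart of `ρ` (`simplexAffine`, `SimplexDisc.lean`:
  `A(0) = v₀`, `A(eⱼ) = v_{j+1}`), with `Δ ⊆ Φ.target`.  So in the chart `Φ` the simplex `f(conv ρ)`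
  and all its faces are flat.

Proof: `h = g ∘ A` (`g` the smooth extension of `f|conv ρ`) is `C^∞` near `Δ` with injective,
hence bijective, differential at the points of `Δ` (the differential of `A` is an injection onto
the direction space of `ρ`, on which `dg` is injective), so a local diffeomorphism near `Δ`
(inverse function theorem, `isLocalDiffeomorphAt_of_mfderiv_injective`); it is injective on the
compact `Δ` (`f` is injective on `|K|`), hence on a neighbourhood `W` of `Δ`
(`exists_isOpen_injOn_of_isCompact`), and an injective local diffeomorphism on an open set
inverts to a chart smooth in both directions (`exists_chart_of_injOn_of_isLocalDiffeomorphAt`),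
i.e. a chart of the maximal atlas.  Munkres (1966), §8 (proof of Thm. 8.4: a non-degenerate
`C^r` embedding of a complex is locally a `C^r` coordinate system on top simplices); Lee (2013),
Thm. 4.5, Prop. 4.8, Prop. 5.2.

Everything here is proved; no definitions, no named facts.

## References

* J. R. Munkres, *Elementary differential topology*, Ann. of Math. Studies 54 (rev. 1966), §8,
  Def. 8.1, Def. 8.3, Thm. 8.4. [Munkres1966]
* J. M. Lee, *Introduction to Smooth Manifolds*, 2nd ed., GTM 218 (2013), Thm. 4.5, Prop. 4.8,
  Prop. 5.2. [LeeSmoothManifolds2013]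
* M. W. Hirsch, *Smooth regular neighborhoods*, Ann. of Math. (2) 76 (1962) 524–530. [Hirsch1962]
-/

open scoped Manifold ContDiff Topology
open Set Function

noncomputable section

namespace Literature.Topology.FourManifolds

universe u

variable {n N : ℕ} {M : Type u} [TopologicalSpace M] [T2Space M]
  [ChartedSpace (EuclideanSpace ℝ (Fin (n + 1))) M] [IsManifold (𝓡 (n + 1)) ∞ M]

/-- The affine chart of a simplex is `C^∞` with differential its linear part (as a continuous
linear map). [folklore] -/
theorem hasFDerivAt_simplexAffine {W : Type*} [NormedAddCommGroup W] [NormedSpace ℝ W] {k : ℕ}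
    (v : Fin (k + 1) → W) (y : EuclideanSpace ℝ (Fin k)) :
    HasFDerivAt (simplexAffine v) (LinearMap.toContinuousLinearMap (simplexLinear v)) y := by
  have h := ((LinearMap.toContinuousLinearMap (simplexLinear v)).hasFDerivAt (x := y)).const_add
    (v 0)
  exact h

/-- The affine chart of a simplex is `C^∞`. [folklore] -/
theorem contDiff_simplexAffine {W : Type*} [NormedAddCommGroup W] [NormedSpace ℝ W] {k : ℕ}
    (v : Fin (k + 1) → W) : ContDiff ℝ ∞ (simplexAffine v) := by
  have : (⇑(simplexAffine v) : EuclideanSpace ℝ (Fin k) → W) =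
      fun y => v 0 + LinearMap.toContinuousLinearMap (simplexLinear v) y := rfl
  rw [this]
  exact contDiff_const.add (LinearMap.toContinuousLinearMap (simplexLinear v)).contDiff

/-- The linear part of the affine chart takes values in the direction space of the vertices.
[folklore] -/
theorem simplexLinear_mem_vectorSpan {W : Type*} [NormedAddCommGroup W] [NormedSpace ℝ W] {k : ℕ}
    (v : Fin (k + 1) → W) (y : EuclideanSpace ℝ (Fin k)) :
    simplexLinear v y ∈ vectorSpan ℝ (range v) := by
  change (∑ j, y j • (v j.succ - v 0)) ∈ vectorSpan ℝ (range v)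
  refine Submodule.sum_mem _ fun j _ => Submodule.smul_mem _ _ ?_
  exact vsub_mem_vectorSpan ℝ (mem_range_self _) (mem_range_self _)

/-- The linear part of the affine chart of an affinely independent simplex is injective.
[folklore] -/
theorem injective_simplexLinear {W : Type*} [NormedAddCommGroup W] [NormedSpace ℝ W] {k : ℕ}
    {v : Fin (k + 1) → W} (hv : AffineIndependent ℝ v) : Injective (simplexLinear v) := by
  intro y z h
  apply injective_simplexAffine hv
  change v 0 + simplexLinear v y = v 0 + simplexLinear v z
  rw [h]

/-- The affine chart carries the model simplex `conv(0, e₀, …, e_{k-1})` onto the simplex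
`conv(v₀, …, v_k)`. [folklore] -/
theorem image_simplexAffine_convexHull_modelVertex {W : Type*} [NormedAddCommGroup W]
    [NormedSpace ℝ W] {k : ℕ} (v : Fin (k + 1) → W) :
    simplexAffine v '' convexHull ℝ (range (modelVertex k)) = convexHull ℝ (range v) := by
  rw [AffineMap.image_convexHull, ← range_comp]
  congr 2
  funext i
  exact simplexAffine_modelVertex v i

/-- An enumeration `v` of a face of a simplicial complex is affinely independent. [folklore] -/
theorem affineIndependent_of_image_mem_faces {k : ℕ}
    {K : Geometry.SimplicialComplex ℝ (EuclideanSpace ℝ (Fin N))}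
    {v : Fin (k + 1) → EuclideanSpace ℝ (Fin N)} (hv : Injective v)
    (hρ : Finset.univ.image v ∈ K.faces) : AffineIndependent ℝ v := by
  classical
  have hind := K.indep hρ
  have hmem : ∀ i, v i ∈ ((Finset.univ.image v : Finset _) : Set (EuclideanSpace ℝ (Fin N))) :=
    fun i => by simp
  let e : Fin (k + 1) ↪ ((Finset.univ.image v : Finset _) : Set (EuclideanSpace ℝ (Fin N))) :=
    ⟨fun i => ⟨v i, hmem i⟩, fun i j h => hv (congrArg Subtype.val h)⟩
  have := hind.comp_embedding e
  exact this

omit [T2Space M] [IsManifold (𝓡 (n + 1)) ∞ M] in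
/-- A smooth complex embedding is injective on the polyhedron. [folklore] -/
theorem IsSmoothComplexEmbedding.injOn_space
    {K : Geometry.SimplicialComplex ℝ (EuclideanSpace ℝ (Fin N))}
    {f : EuclideanSpace ℝ (Fin N) → M} (hf : IsSmoothComplexEmbedding (n + 1) K f) :
    InjOn f K.space :=
  injOn_iff_injective.2 hf.2.1.injective

/-- **A chart in which a top-dimensional simplex is flat.**  Let `f` be a smooth non-degenerate
embedding of the finite complex `K ⊆ E^N` into the smooth `(n+1)`-manifold `M`
(`IsSmoothComplexEmbedding`) and `v : Fin (n + 2) → E^N` an injective enumeration of a face of `K`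
with `n + 2` vertices.  Then there is a chart `Φ` of the maximal `C^∞` atlas of `M` with the model
simplex `Δ = conv(0, e₀, …, e_n)` inside its target and `Φ⁻¹ = f ∘ simplexAffine v` on `Δ`
(so `Φ(f(conv ρ)) = Δ`, faces corresponding to faces).  Munkres (1966), §8, proof of Thm. 8.4;
inverse function theorem, Lee (2013), Thm. 4.5 / Prop. 5.2. [cite: Munkres1966, §8 Thm. 8.4 (proof)] -/
theorem IsSmoothComplexEmbedding.exists_chart_simplexAffine
    {K : Geometry.SimplicialComplex ℝ (EuclideanSpace ℝ (Fin N))}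
    {f : EuclideanSpace ℝ (Fin N) → M} (hf : IsSmoothComplexEmbedding (n + 1) K f)
    {v : Fin (n + 2) → EuclideanSpace ℝ (Fin N)} (hv : Injective v)
    (hρ : Finset.univ.image v ∈ K.faces) :
    ∃ Φ : OpenPartialHomeomorph M (EuclideanSpace ℝ (Fin (n + 1))),
      Φ ∈ IsManifold.maximalAtlas (𝓡 (n + 1)) ∞ M ∧
      convexHull ℝ (range (modelVertex (n + 1))) ⊆ Φ.target ∧
      ∀ y ∈ convexHull ℝ (range (modelVertex (n + 1))), Φ.symm y = f (simplexAffine v y) := by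
  classical
  set ρ : Finset (EuclideanSpace ℝ (Fin N)) := Finset.univ.image v with hρdef
  have hρcoe : ((ρ : Set (EuclideanSpace ℝ (Fin N)))) = range v := by
    simp [hρdef]
  obtain ⟨g, u, hu, hsub, hg, hfg, hinjd⟩ := hf.2.2 ρ hρ
  have hvai : AffineIndependent ℝ v := affineIndependent_of_image_mem_faces hv hρ
  set A := simplexAffine v with hA
  set L : EuclideanSpace ℝ (Fin (n + 1)) →L[ℝ] EuclideanSpace ℝ (Fin N) :=
    LinearMap.toContinuousLinearMap (simplexLinear v) with hL
  have hAcont : Continuous A := (contDiff_simplexAffine v).continuous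
  set Δ : Set (EuclideanSpace ℝ (Fin (n + 1))) := convexHull ℝ (range (modelVertex (n + 1)))
    with hΔ
  have hΔc : IsCompact Δ := (finite_range (modelVertex (n + 1))).isCompact_convexHull ℝ
  have hAΔ : A '' Δ = convexHull ℝ (ρ : Set (EuclideanSpace ℝ (Fin N))) := by
    rw [hρcoe]; exact image_simplexAffine_convexHull_modelVertex v
  have hAΔ' : ∀ y ∈ Δ, A y ∈ convexHull ℝ (ρ : Set (EuclideanSpace ℝ (Fin N))) := fun y hy =>
    hAΔ ▸ mem_image_of_mem A hy
  -- the map `h = g ∘ A`, smooth on `W₁ = A⁻¹ u ⊇ Δ`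
  set h : EuclideanSpace ℝ (Fin (n + 1)) → M := g ∘ A with hh
  set W₁ : Set (EuclideanSpace ℝ (Fin (n + 1))) := A ⁻¹' u with hW₁
  have hW₁o : IsOpen W₁ := hu.preimage hAcont
  have hΔW₁ : Δ ⊆ W₁ := fun y hy => hsub (hAΔ' y hy)
  have hAs : ContMDiff 𝓘(ℝ, EuclideanSpace ℝ (Fin (n + 1))) 𝓘(ℝ, EuclideanSpace ℝ (Fin N)) ∞ A :=
    (contDiff_simplexAffine v).contMDiff
  have hhs : ContMDiffOn 𝓘(ℝ, EuclideanSpace ℝ (Fin (n + 1))) (𝓡 (n + 1)) ∞ h W₁ :=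
    hg.comp hAs.contMDiffOn fun y hy => hy
  have hn0 : (∞ : ℕ∞ω) ≠ 0 := by simp
  -- the differential of `h` is injective at the points of `Δ`
  have hmf : ∀ y ∈ Δ, Injective (mfderiv 𝓘(ℝ, EuclideanSpace ℝ (Fin (n + 1))) (𝓡 (n + 1)) h y) := by
    intro y hy
    have hgd : MDifferentiableAt 𝓘(ℝ, EuclideanSpace ℝ (Fin N)) (𝓡 (n + 1)) g (A y) :=
      (hg.contMDiffAt (hu.mem_nhds (hΔW₁ hy))).mdifferentiableAt hn0
    have hAd : MDifferentiableAt 𝓘(ℝ, EuclideanSpace ℝ (Fin (n + 1)))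
        𝓘(ℝ, EuclideanSpace ℝ (Fin N)) A y := (hAs y).mdifferentiableAt hn0
    have hAmf : HasMFDerivAt 𝓘(ℝ, EuclideanSpace ℝ (Fin (n + 1))) 𝓘(ℝ, EuclideanSpace ℝ (Fin N))
        A y L := hasMFDerivAt_iff_hasFDerivAt.2 (hasFDerivAt_simplexAffine v y)
    have hmA : mfderiv 𝓘(ℝ, EuclideanSpace ℝ (Fin (n + 1))) 𝓘(ℝ, EuclideanSpace ℝ (Fin N)) A y = L :=
      hAmf.mfderiv
    have hcomp := mfderiv_comp y hgd hAd
    change Injective (mfderiv 𝓘(ℝ, EuclideanSpace ℝ (Fin (n + 1))) (𝓡 (n + 1)) (g ∘ A) y)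
    rw [hcomp, hmA]
    intro w₁ w₂ hw
    have hL1 : L w₁ ∈ (vectorSpan ℝ (ρ : Set (EuclideanSpace ℝ (Fin N))) : Set _) := by
      rw [hρcoe]; exact simplexLinear_mem_vectorSpan v w₁
    have hL2 : L w₂ ∈ (vectorSpan ℝ (ρ : Set (EuclideanSpace ℝ (Fin N))) : Set _) := by
      rw [hρcoe]; exact simplexLinear_mem_vectorSpan v w₂
    have := hinjd (A y) (hAΔ' y hy) hL1 hL2 hw
    exact injective_simplexLinear hvai this
  -- `h` is a local diffeomorphism at the points of `Δ`
  have hloc : ∀ y ∈ Δ, IsLocalDiffeomorphAt 𝓘(ℝ, EuclideanSpace ℝ (Fin (n + 1))) (𝓡 (n + 1)) ∞ h y :=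
    fun y hy => isLocalDiffeomorphAt_of_mfderiv_injective hW₁o (hΔW₁ hy) hhs
      (by exact_mod_cast le_top) rfl (hmf y hy)
  -- `h` is injective on `Δ`
  have hinjΔ : InjOn h Δ := by
    intro y₁ hy₁ y₂ hy₂ hy
    have h1 : f (A y₁) = f (A y₂) := by
      rw [hfg _ (hAΔ' y₁ hy₁), hfg _ (hAΔ' y₂ hy₂)]; exact hy
    have h2 := hf.injOn_space (K.convexHull_subset_space hρ (hAΔ' y₁ hy₁))
      (K.convexHull_subset_space hρ (hAΔ' y₂ hy₂)) h1
    exact injective_simplexAffine hvai h2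
  -- an open neighbourhood `W` of `Δ` on which `h` is an injective local diffeomorphism
  obtain ⟨W₃, hW₃o, hΔW₃, hinjW₃⟩ := exists_isOpen_injOn_of_isCompact hΔc
    (fun y hy => (hloc y hy).contMDiffAt.continuousAt) hinjΔ
    fun y hy => exists_injOn_nhds_of_isLocalDiffeomorphAt (hloc y hy)
  set W : Set (EuclideanSpace ℝ (Fin (n + 1))) :=
    W₃ ∩ {y | IsLocalDiffeomorphAt 𝓘(ℝ, EuclideanSpace ℝ (Fin (n + 1))) (𝓡 (n + 1)) ∞ h y} with hW
  have hWo : IsOpen W :=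
    hW₃o.inter (isOpen_iff_mem_nhds.2 fun y hy => eventually_isLocalDiffeomorphAt hy)
  have hΔW : Δ ⊆ W := fun y hy => ⟨hΔW₃ hy, hloc y hy⟩
  obtain ⟨Φ, -, hΦt, hΦsymm, -, hΦs, hΦs'⟩ :=
    exists_chart_of_injOn_of_isLocalDiffeomorphAt (I := 𝓘(ℝ, EuclideanSpace ℝ (Fin (n + 1))))
      (J := 𝓡 (n + 1)) (n := ∞) hWo (fun y hy => hy.2) (hinjW₃.mono inter_subset_left)
  refine ⟨Φ, Φ.mem_maximalAtlas_of_contMDiffOn hΦs hΦs', hΦt.symm ▸ hΔW, fun y hy => ?_⟩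
  rw [hΦsymm, hh, comp_apply, ← hfg _ (hAΔ' y hy)]

end Literature.Topology.FourManifolds
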